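import Literature.NumberTheory.LFunctions.DeBruijnNewman
import HarnessLib

/-!
# de Bruijn's strip theorem for the family `H_t`

Trunk T-ANT (`Literature/NumberTheory/LFunctions`), route `RiemannHypothesis/DBN` (cruxes #2/#3).

N. G. de Bruijn, *The roots of trigonometric integrals*, Duke Math. J. 17 (1950), 197–226,
**Theorem 13** (in the normalisation `H_t(z) = ∫₀^∞ e^{tu²} Φ(u) cos(zu) du` of
`DeBruijnNewman.lean` = Rodgers–Tao 2020, eq. (1)/(4)): if all zeros of `H_t` lie in the strip
`|Im z| ≤ Δ`, then for every `t' ≥ t + Δ²/2` the function `H_{t'}` has only real zeros. (With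
`Δ = 0` this is de Bruijn's monotonicity "real zeros at time `t` ⇒ real zeros at all later
times", already recorded as `HasOnlyRealZeros.mono_deBruijnH`; with the classical strip
`|Im z| ≤ 1` for `H_0 = Ξ(z/2)/8` it gives de Bruijn's bound `Λ ≤ 1/2`.)

We vendor the statement as the named fact `Literature.NumberTheory.LFunctions.de_bruijn_strip` in exactly the signature wanted
by the route, and prove the `Δ = 0` specialisation from it. The companion monotonicity of the
*number* of non-real zeros (Csordas–Smith–Varga 1994) is not recorded here: the tree has no
zero-counting-with-multiplicity API for `H_t`.

## References

* N. G. de Bruijn, *The roots of trigonometric integrals*, Duke Math. J. 17 (1950), Thm. 13.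
* B. Rodgers, T. Tao, *The de Bruijn–Newman constant is non-negative*, Forum Math. Pi 8 (2020),
  §1 (the family `H_t`, de Bruijn's results).
* G. Csordas, W. Smith, R. S. Varga, *Lehmer pairs of zeros, the de Bruijn–Newman constant Λ, and
  the Riemann Hypothesis*, Constr. Approx. 10 (1994) (monotonicity of non-real zeros).
-/

noncomputable section

namespace Literature.NumberTheory.LFunctions

/-- **de Bruijn 1950, Theorem 13** (strip version). Let `t, Δ ∈ ℝ`, `0 ≤ Δ`, and suppose every
zero `z` of `H_t = deBruijnH t` satisfies `|Im z| ≤ Δ`. Then `H_{t₂}` has only real zeros for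
every `t₂ ≥ t + Δ²/2`. [cite: Bruijn1950, Thm. 13] -/
def de_bruijn_strip : Prop :=
  ∀ t Δ : ℝ, 0 ≤ Δ → (∀ z : ℂ, deBruijnH t z = 0 → |z.im| ≤ Δ) →
    ∀ t₂ : ℝ, t + Δ ^ 2 / 2 ≤ t₂ → HasOnlyRealZeros (deBruijnH t₂)

/-- The case `Δ = 0` of the strip theorem: if `H_t` has only real zeros then so does `H_{t₂}`
for every `t₂ ≥ t` (de Bruijn's monotonicity; cf. `HasOnlyRealZeros.mono_deBruijnH`).
[cite: Bruijn1950, Thm. 13] -/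
theorem de_bruijn_strip.mono (h : de_bruijn_strip) {t t₂ : ℝ}
    (ht : HasOnlyRealZeros (deBruijnH t)) (htt : t ≤ t₂) : HasOnlyRealZeros (deBruijnH t₂) := by
  refine h t 0 le_rfl (fun z hz => ?_) t₂ (by simpa using htt)
  rw [ht z hz, abs_zero]

/-- Reformulation with the conclusion at the threshold time `t + Δ²/2` itself.
[cite: Bruijn1950, Thm. 13] -/
theorem de_bruijn_strip.at_threshold (h : de_bruijn_strip) {t Δ : ℝ} (hΔ : 0 ≤ Δ)
    (hstrip : ∀ z : ℂ, deBruijnH t z = 0 → |z.im| ≤ Δ) :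
    HasOnlyRealZeros (deBruijnH (t + Δ ^ 2 / 2)) :=
  h t Δ hΔ hstrip _ le_rfl

end Literature.NumberTheory.LFunctions
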